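import Literature.NumberTheory.EllipticCurves.RootNumberTwistProofs
import HarnessLib

/-!
# The root number of a quadratic twist of a semistable elliptic curve, from the Modularity Theorem

For a semistable elliptic curve `E / ℚ` (squarefree conductor) and a squarefree integer `d`, every
additive prime `p ≥ 5` of the quadratic twist `E^{(d)}` divides `d`, and
`(E^{(d)})^{(p*)} = E^{(d p*)} ≅ E^{(± d/p)}` is semistable at `p`: the additive primes of `E^{(d)}` are of
quadratic-twist type. Hence, by `RootNumberTwistProofs`, `w(E^{(d)}) = −∏_p W_p(E^{(d)})` — the named
fact `WeierstrassCurve.rootNumber_eq_algebraicRootNumber` for `E^{(d)}`, whose own hypothesis excludes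
additive reduction at `2, 3` — follows from the Modularity Theorem `exists_isNewformOf` **alone**
(`rootNumber_eq_algebraicRootNumber_quadraticTwist_of_squarefree`).

Ingredients: a twist by a `v`-adic unit does not change the reduction type at an odd place `v`
(`hasReductionAt_quadraticTwist_iff_of_not_dvd`; Silverman *AEC* VII.5 Prop. 5.1 with VII.1
Prop. 1.3 — a minimal model twists to a minimal model, `isMinimal_quadraticTwist`), a twist by a
square is a change of variables (`exists_variableChange_smul_eq_quadraticTwist_sq`, *AEC* X.5
Cor. 5.4), and the reduction type is an isomorphism invariant (`hasAdditiveReductionAt_smul_iff_holds`).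

## References

* L. Cowland Kellock, V. Dokchitser, *Root numbers and parity phenomena*, Bull. LMS 55 (2023),
  Rem. 2.2, Cor. 2.5.
* J. H. Silverman, *The Arithmetic of Elliptic Curves*, GTM 106, 2nd ed. 2009, VII.5 Prop. 5.1,
  X.5 Cor. 5.4.
-/

noncomputable section

open scoped Classical

open Literature.NumberTheory.EllipticCurves.ModularForms IsDedekindDomain
  IsDedekindDomain.HeightOneSpectrum NumberField Rat.HeightOneSpectrum

namespace WeierstrassCurve

variable (W : WeierstrassCurve ℚ)

/-- **A twist by a `v`-adic unit has the same reduction type at an odd place `v` of `ℤ`**: `d` and `2`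
are units of `O_v`, so the chosen minimal model `X` of `E` at `v` twists to a *minimal* model
`X^{(d)}` of `E^{(d)}` (`isMinimal_quadraticTwist`) with `v(Δ)` and `v(c₄)` unchanged
(`hasGoodReduction_quadraticTwist_iff` etc.), and the reduction type does not depend on the minimal
model (Silverman, *AEC* VII.1 Prop. 1.3(b)). [cite: SilvermanAEC2009, VII.5 Prop. 5.1 and VII.1 Prop. 1.3] -/
theorem hasReductionAt_quadraticTwist_iff_of_not_dvd [W.IsElliptic] (v : HeightOneSpectrum ℤ)
    (hv2 : natGenerator v ≠ 2) {d : ℤ} (hℓd : ¬ ((natGenerator v : ℕ) : ℤ) ∣ d) :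
    ((W.quadraticTwist (d : ℚ)).HasGoodReductionAt v ↔ W.HasGoodReductionAt v) ∧
      ((W.quadraticTwist (d : ℚ)).HasMultiplicativeReductionAt v ↔ W.HasMultiplicativeReductionAt v) ∧
      ((W.quadraticTwist (d : ℚ)).HasAdditiveReductionAt v ↔ W.HasAdditiveReductionAt v) := by
  haveI : NeZero (2 : v.adicCompletion ℚ) := ⟨by
    rw [← map_ofNat (algebraMap ℚ (v.adicCompletion ℚ)) 2]; exact (map_ne_zero _).mpr two_ne_zero⟩
  set O := v.adicCompletionIntegers ℚ
  set K := v.adicCompletion ℚ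
  have hq : (natGenerator v).Prime := prime_natGenerator v
  have hdZ : d ≠ 0 := fun h ↦ hℓd (by rw [h]; exact dvd_zero _)
  have hd0 : (d : ℚ) ≠ 0 := by exact_mod_cast hdZ
  haveI : (W.quadraticTwist (d : ℚ)).IsElliptic := W.isElliptic_quadraticTwist hd0
  haveI : (W.baseChange K).IsElliptic := by change (W.map _).IsElliptic; infer_instance
  set Xm := W.localMinimalModel v with hXm
  haveI : Xm.IsElliptic := W.isElliptic_localMinimalModel v
  obtain ⟨C, hX⟩ : ∃ C : VariableChange K, W.baseChange K = C • Xm :=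
    ⟨_, (inv_smul_smul ((W.baseChange K).exists_isMinimal O).choose (W.baseChange K)).symm⟩
  have htwK : (W.quadraticTwist (d : ℚ)).baseChange K = (W.baseChange K).quadraticTwist (d : K) := by
    rw [baseChange, map_quadraticTwist, map_intCast]; rfl
  have hℓ2 : ¬ ((natGenerator v : ℕ) : ℤ) ∣ 2 := fun h ↦
    hv2 ((Nat.prime_dvd_prime_iff_eq hq Nat.prime_two).mp (Int.natCast_dvd_natCast.mp h))
  have hu := isUnit_int_adicCompletionIntegers_intCast v hℓd
  have h2 : IsUnit (2 : O) := by simpa using isUnit_int_adicCompletionIntegers_intCast v hℓ2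
  haveI hYmin : IsMinimal O (Xm.quadraticTwist (algebraMap O K hu.unit)) := isMinimal_quadraticTwist O Xm h2 _
  have hg : (Xm.quadraticTwist (algebraMap O K hu.unit)).HasGoodReduction O ↔ Xm.HasGoodReduction O :=
    hasGoodReduction_quadraticTwist_iff O
  have hm : (Xm.quadraticTwist (algebraMap O K hu.unit)).HasMultiplicativeReduction O ↔
      Xm.HasMultiplicativeReduction O :=
    hasMultiplicativeReduction_quadraticTwist_iff O
  have ha : (Xm.quadraticTwist (algebraMap O K hu.unit)).HasAdditiveReduction O ↔ Xm.HasAdditiveReduction O :=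
    hasAdditiveReduction_quadraticTwist_iff O
  have hdK : (d : K) = algebraMap O K hu.unit := by
    rw [IsUnit.unit_spec, algebraMap_int_adicCompletionIntegers_intCast, map_intCast]
  have hW'Y : (W.quadraticTwist (d : ℚ)).baseChange K =
      (⟨C.u, (d : K) * C.r, 0, 0⟩ : VariableChange K) • Xm.quadraticTwist (algebraMap O K hu.unit) := by
    rw [htwK, hX, quadraticTwist_smul, hdK]
  set Y := Xm.quadraticTwist (algebraMap O K hu.unit) with hY
  haveI : Y.IsElliptic := Xm.isElliptic_quadraticTwist (by
    rw [← hdK, ← map_intCast (algebraMap ℚ K) d]; exact (map_ne_zero _).mpr hd0)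
  have hrel : (W.quadraticTwist (d : ℚ)).localMinimalModel v =
      ((((W.quadraticTwist (d : ℚ)).baseChange K).exists_isMinimal O).choose *
        (⟨C.u, (d : K) * C.r, 0, 0⟩ : VariableChange K)) • Y := by
    rw [mul_smul, ← hW'Y]; rfl
  have hΔY : Y.Δ ≠ 0 := Y.isUnit_Δ.ne_zero
  refine ⟨?_, ?_, ?_⟩
  · change ((W.quadraticTwist (d : ℚ)).localMinimalModel v).HasGoodReduction O ↔ Xm.HasGoodReduction O
    rw [hasGoodReduction_iff_of_isMinimal_of_eq_smul O hrel, hg]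
  · change ((W.quadraticTwist (d : ℚ)).localMinimalModel v).HasMultiplicativeReduction O ↔
      Xm.HasMultiplicativeReduction O
    rw [hasMultiplicativeReduction_iff_of_isMinimal_of_eq_smul O hrel hΔY, hm]
  · change ((W.quadraticTwist (d : ℚ)).localMinimalModel v).HasAdditiveReduction O ↔ Xm.HasAdditiveReduction O
    rw [hasAdditiveReduction_iff_of_isMinimal_of_eq_smul O hrel hΔY, ha]

/-- **A semistable curve has no additive prime**: if `N_E` is squarefree then `f_v ≤ 1` at every place,
while additive reduction means `f_v ≥ 2` (`two_le_conductorExponent_iff_holds`,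
`factorization_conductorNorm_holds`). [cite: SilvermanATAEC1994, Thm. IV.10.2] -/
theorem not_hasAdditiveReductionAt_of_squarefree_conductorNorm [W.IsElliptic]
    (hsq : Squarefree (W.conductorNorm ℤ)) (v : HeightOneSpectrum ℤ) : ¬ W.HasAdditiveReductionAt v := by
  intro ha
  have h2 := (two_le_conductorExponent_iff_holds v W).mpr ha
  have h1 := (Nat.squarefree_iff_factorization_le_one (W.conductorNorm_pos_holds).ne').mp hsq (natGenerator v)
  rw [factorization_conductorNorm_holds W v] at h1
  omega

/-- **`w(E^{(d)}) = −∏_p W_p(E^{(d)})` from the Modularity Theorem alone, for `E` semistable and `d`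
squarefree.** Every additive prime `p ≥ 5` of `E^{(d)}` divides `d` (else `d` is a `p`-unit and `E^{(d)}`
has the reduction type of `E` at `p`, `hasReductionAt_quadraticTwist_iff_of_not_dvd`), and then
`(E^{(d)})^{(p*)} = E^{(± (d/p) p²)} ≅ E^{(± d/p)}` (`exists_variableChange_smul_eq_quadraticTwist_sq`) is,
like `E`, not additive at `p`; so `rootNumber_eq_algebraicRootNumber_of_exists_isNewformOf_of_twist`
applies. (Kellock–Dokchitser 2023, Rem. 2.2: the local root numbers of such twists are classical.)
[cite: KellockDokchitser2023, Rem. 2.2 and Cor. 2.5] [cite: SilvermanAEC2009, X.5 Cor. 5.4] -/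
theorem rootNumber_eq_algebraicRootNumber_quadraticTwist_of_squarefree (hmod : exists_isNewformOf)
    [W.IsElliptic] (hsq : Squarefree (W.conductorNorm ℤ)) {d : ℤ} (hd : Squarefree d) :
    (W.quadraticTwist (d : ℚ)).rootNumber_eq_algebraicRootNumber := by
  have hdZ : d ≠ 0 := hd.ne_zero
  haveI := W.isElliptic_quadraticTwist (show (d : ℚ) ≠ 0 by exact_mod_cast hdZ)
  intro _ h23
  refine (W.quadraticTwist (d : ℚ)).rootNumber_eq_algebraicRootNumber_of_exists_isNewformOf_of_twist hmod
    (fun p hp5 hadd ↦ ?_) h23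
  haveI := Fact.mk p.2
  have hgen : natGenerator ((primesEquiv (R := ℤ)).symm p) = p :=
    congrArg (fun q : Nat.Primes ↦ (q : ℕ)) ((primesEquiv (R := ℤ)).apply_symm_apply p)
  have hp2 : (p : ℕ) ≠ 2 := by omega
  have hv2 : natGenerator ((primesEquiv (R := ℤ)).symm p) ≠ 2 := by rwa [hgen]
  have hWna := W.not_hasAdditiveReductionAt_of_squarefree_conductorNorm hsq ((primesEquiv (R := ℤ)).symm p)
  -- `p ∣ d`, `d = p u` with `p ∤ u`
  have hpd : (p : ℤ) ∣ d := by
    by_contra h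
    exact hWna ((W.hasReductionAt_quadraticTwist_iff_of_not_dvd _ hv2 (d := d) (by rwa [hgen])).2.2.mp hadd)
  obtain ⟨u, hu⟩ := hpd
  have hu0 : u ≠ 0 := by rintro rfl; exact hdZ (by rw [hu, mul_zero])
  have hpu : ¬ ((p : ℕ) : ℤ) ∣ u := by
    rintro ⟨w, hw⟩
    have hunit : IsUnit ((p : ℕ) : ℤ) := hd p ⟨w, by rw [hu, hw]; ring⟩
    exact p.2.ne_one (Nat.isUnit_iff.mp (Int.ofNat_isUnit.mp hunit))
  -- `(E^{(d)})^{(p*)} = E^{(± u p²)} ≅ C • E^{(± u)}`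
  set s : ℤ := (-1 : ℤ) ^ ((p : ℕ) / 2) with hs
  have hsu0 : ((s * u : ℤ) : ℚ) ≠ 0 := by
    have : s * u ≠ 0 := mul_ne_zero (pow_ne_zero _ (by norm_num)) hu0
    exact_mod_cast this
  haveI := W.isElliptic_quadraticTwist hsu0
  have key : (W.quadraticTwist (d : ℚ)).quadraticTwist ((((-1 : ℤ) ^ ((p : ℕ) / 2) * p : ℤ)) : ℚ) =
      (W.quadraticTwist ((s * u : ℤ) : ℚ)).quadraticTwist (((p : ℕ) : ℚ) ^ 2) := by
    rw [quadraticTwist_quadraticTwist, quadraticTwist_quadraticTwist, hu, ← hs]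
    congr 1
    push_cast
    ring
  obtain ⟨C, hC⟩ := (W.quadraticTwist ((s * u : ℤ) : ℚ)).exists_variableChange_smul_eq_quadraticTwist_sq
    (θ := ((p : ℕ) : ℚ)) (by exact_mod_cast p.2.ne_zero)
  have hsu : ¬ ((natGenerator ((primesEquiv (R := ℤ)).symm p) : ℕ) : ℤ) ∣ s * u := by
    rw [hgen]
    intro h
    exact hpu (((isUnit_neg_one (α := ℤ)).pow _).dvd_mul_left.mp h)
  rw [key, ← hC, hasAdditiveReductionAt_smul_iff_holds _ (W.quadraticTwist ((s * u : ℤ) : ℚ)) C,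
    (W.hasReductionAt_quadraticTwist_iff_of_not_dvd _ hv2 hsu).2.2]
  exact hWna

end WeierstrassCurve

end
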